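import Summits.QuantumFields.YangMills.Theorems.BalabanUVNodesN15KingModelTwoPointJointLimit
import Summits.QuantumFields.YangMills.Theorems.BalabanUVNodesN15KingModelTwoPointInfiniteVolumeDecay
import Literature.MathematicalPhysics.QuantumFieldTheory.Balaban1983to89.B5Prop11Leaves

/-!
# BalabanUVNodes ∕ N15 — THE KING-MODEL RUNG (PART Ϝ-n): THE THERMODYNAMIC LIMIT AT FINITE `K` —
# `S₂^{(K)}_Ω(0,z) → V_K(z) := N^{d+1}(2π)^{−(d+1)}∫_{(−π,π]^{d+1}} |u(θ)|²cos(Nθ·z)∕(m² + N²Σ(2−2cos θ_μ)) dθ` (`N = L^K`) as all periods `→ ∞` (the square closes in part Ϝ-o)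
# (Track A, DAG node N15 = NE2; FAN-OUT v1.1 §N15 s3 «KING-MODEL RUNG … NE2's analogue DECIDED in the model»)

HONEST FRAMING.  Count-neutral (cell `pub-ymgap`, seat `pub-ymgap-dag-n15-e` g33; `--supports stmt-QuantumFields-27366 --as helper` = K3⁸
`SpineGivenEndpointR13SepCoPHV`).  TEMPLATE LITERATURE: C. King, *The U(1) Higgs model. I. The continuum limit*, Commun. Math. Phys. **102** (1986) 649–677
[King1986] — KING's OWN `A = 0`, `g = 0` MODEL.  Parts Ϝ-d∕Ϝ-j∕Ϝ-l gave three sides of the square of limits (`K → ∞` at fixed volume; then `|Ω| → ∞`; and the joint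
limit); this file gives the fourth: the infinite-volume limit AT FIXED `K` (fine lattice spacing `η = L^{−K}` kept); part Ϝ-o closes the square.  NOT the interacting model; NOT
Bałaban's objects; NOT a node discharge (N15 is booked through n15-a's knit, untouched here); nothing continuum-Yang–Mills ∕ ℝ⁴ ∕ OS ∕ mass-gap ∕ Clay.  0 `sorry`; standard
axioms; THREE definitions (`fineIntegrand`, `fineBoxFun`, `kingS2InfK` — the finite-`K` limit object and its integrand).

THE MATHEMATICS.  `S₂^{(K)}_Ω(0,z) = |Ω|⁻¹Σ_q S_N(q)Re e^{iq·z}` with `S_N(q) = Σ_{p∈fib q}|u(p)|²∕σ(p)` a sum over the FINE momenta above `q`; since `e^{iq·z} = e^{ip·(Nz)}` at block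
corners (`chi_corner`), the double sum is ONE sum over the fine torus `Ω̂_η`: `S₂^{(K)}_Ω(0,z) = N^{d+1}|Ω̂_η|⁻¹Σ_{p∈Ω̂_η} F(θ_p)`, `F(θ) = |u(θ)|²cos(θ·Nz)∕(m² + N²Σ_μ(2−2cosθ_μ))`,
`θ_p ∈ (−π,π]^{d+1}` the centred fine angles (mesh `2π∕(NM_ν)`).  Reading the centred representatives as the lattice points of `(2π∕(NM))ℤ^{d+1}` that fall in the
half-open box `(−π,π]^{d+1}`, this is a lattice Riemann sum over ALL of `ℝ^{d+1}` of `F·1_{(−π,π]^{d+1}}` — continuous off the box boundary (a null set), where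
`|u(θ)|² = Π_μ (sinc(Nθ_μ∕2)∕sinc(θ_μ∕2))²` (the filled printed symbol (4.36)) is continuous on `|θ_μ| < 2π`; dominated by `m⁻²·Π_μ1_{|θ_μ|≤π}` (`|sin Nx| ≤ N|sin x|`), whence
part Ϝ-i's engine (a.e. form): `S₂^{(K)}_Ω(0,z) → V_K(z) = N^{d+1}(2π)^{−(d+1)}∫_{box}F`.

WHAT THIS FILE PROVES (kernel).  §1 `tendsto_latticeSum_of_dominated_ae` (Ϝ-i's DCT with a.e. pointwise convergence).  §2 (`|sin Nx| ≤ N|sin x|` is the tree's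
`B5Prop11Leaves.abs_sin_nat_mul_le`), ★ `uFactorr_zero_eq_sinc_sq` (`|u|²`-factor `= (sinc(Nθ∕2)∕sinc(θ∕2))²`), `uFactorr_zero_le_one`, `continuousAt_qqSymbol`.  §3 `fineIntegrand`, `fineBoxFun`, `re_chi_coarse_eq_cos_fine`
(`Re e^{iq·z} = cos(θ_p·Nz)` on the fibre), `sum_fib_sum`, `torRep_eq_iff_box`, `cornerPt_torRep`, ★★ **`kingS2_eq_fineLatticeSum`** (the finite-`K` kernel as a lattice Riemann sum of
`F·1_{box}` with mesh `2π∕(NM_ν)`).  §4 `kingS2InfK`, `abs_fineIntegrand_le`, `continuousAt_fineIntegrand`, ★★★ **`tendsto_kingS2_volume`** (finite-`K` thermodynamic limit).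

HONEST SCOPE.  Free field; unit-block smearing; `m² > 0`; `N ≥ 1` (for §5 `N = L^K`, odd `L ≥ 3` de facto, `K ≥ 1`).  N15 untouched; counts unmoved.
Locators: [King1986] Thm 2.1 (2.22) p.654, (4.5) p.670, (4.35)–(4.36) p.674, Lemma 4.5 (4.38) p.674.
-/

noncomputable section

open scoped BigOperators
open Finset Filter Topology MeasureTheory Set

namespace Summit.QuantumFields.YangMills.BalabanUVNodes.N15KingModelRung

open Literature.MathematicalPhysics.QuantumFieldTheory.Balaban1983to89.B5Prop11Plancherel (Tor fine chi sOf abs_sOf_le)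
open Literature.MathematicalPhysics.QuantumFieldTheory.Balaban1983to89 (B4Strip.uFactorr B4Strip.S1r B4Strip.Sxir B4Strip.S1r_eq B4Strip.Sxir_eq B4Strip.uFactorr_nonneg)
open Literature.MathematicalPhysics.QuantumFieldTheory.King1986 (qqSymbol qqSymbol_nonneg aK)
open Literature.MathematicalPhysics.QuantumFieldTheory.King1986.Torus
open LatticeRiemann

/-! ## §1 The engine with almost-everywhere pointwise convergence -/

/-- Part Ϝ-i's dominated convergence of lattice sums, with pointwise convergence only ALMOST everywhere. [folklore] -/
theorem tendsto_latticeSum_of_dominated_ae {ι : Type*} [Fintype ι] (ℓ : ℕ → ι → ℝ) (hℓ : ∀ n i, 0 < ℓ n i) (c : ℕ → (ι → ℤ) → ℝ)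
    (F G : (ι → ℝ) → ℝ) (hG : Integrable G) (hdom : ∀ n x, |c n (floorIdx (ℓ n) x)| ≤ G x)
    (hlim : ∀ᵐ x, Tendsto (fun n => c n (floorIdx (ℓ n) x)) atTop (𝓝 (F x))) :
    Tendsto (fun n => ∑' b, (∏ i, ℓ n i) * c n b) atTop (𝓝 (∫ x, F x)) := by
  have hmeas : ∀ n, AEStronglyMeasurable (stepFun (ℓ n) (c n)) volume :=
    fun n => measurable_stepFun.aestronglyMeasurable
  have hbd : ∀ n, ∀ᵐ x ∂volume, ‖stepFun (ℓ n) (c n) x‖ ≤ G x :=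
    fun n => Eventually.of_forall fun x => by rw [Real.norm_eq_abs]; exact hdom n x
  have hint : ∀ n, Integrable (stepFun (ℓ n) (c n)) := fun n => hG.mono' (hmeas n) (hbd n)
  have hconv := tendsto_integral_of_dominated_convergence G hmeas hG hbd hlim
  exact Tendsto.congr (fun n => integral_stepFun (hℓ n) (hint n)) hconv

/-! ## §2 The filled symbol `|u(θ)|²` as a ratio of `sinc`s -/

/- `|sin(Nx)| ≤ N|sin x|` is the tree's `B5Prop11Leaves.abs_sin_nat_mul_le` (reused, not restated). -/

/-- ★ **THE FILLED FACTOR OF (4.36) IS A RATIO OF `sinc`s**: `uFactorr N 0 (Nθ) = (sinc(Nθ∕2)∕sinc(θ∕2))²` for every real `θ` (`N ≥ 1`; both conventions agree at the removable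
and at the degenerate points). [cite: King1986, (4.36) p.674] -/
theorem uFactorr_zero_eq_sinc_sq {N : ℕ} (hN : 1 ≤ N) (θ : ℝ) :
    B4Strip.uFactorr N 0 ((N : ℝ) * θ) = (Real.sinc ((N : ℝ) * θ / 2) / Real.sinc (θ / 2)) ^ 2 := by
  have hN0 : (N : ℝ) ≠ 0 := by exact_mod_cast (show N ≠ 0 by omega)
  unfold B4Strip.uFactorr
  rw [if_pos rfl]
  by_cases hθ : θ = 0
  · subst hθ; simp [Real.sinc_zero]
  · have hx : (N : ℝ) * θ ≠ 0 := mul_ne_zero hN0 hθ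
    rw [if_neg hx, B4Strip.S1r_eq, B4Strip.Sxir_eq, Real.sinc_of_ne_zero (div_ne_zero hx two_ne_zero), Real.sinc_of_ne_zero (div_ne_zero hθ two_ne_zero),
      show (N : ℝ) * θ / (2 * N) = θ / 2 by field_simp]
    by_cases hs : Real.sin (θ / 2) = 0
    · simp [hs]
    · field_simp

/-- `uFactorr N 0 (Nθ) ≤ 1` (`|sin(Nθ∕2)| ≤ N|sin(θ∕2)|`). [cite: King1986, (4.14) p.671] -/
theorem uFactorr_zero_le_one {N : ℕ} (hN : 1 ≤ N) (θ : ℝ) : B4Strip.uFactorr N 0 ((N : ℝ) * θ) ≤ 1 := by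
  have hN0 : (0 : ℝ) < N := by exact_mod_cast (show 0 < N by omega)
  unfold B4Strip.uFactorr
  rw [if_pos rfl]
  split_ifs with hx
  · exact le_rfl
  · rw [B4Strip.S1r_eq, B4Strip.Sxir_eq, show (N : ℝ) * θ / (2 * N) = θ / 2 by field_simp, show (N : ℝ) * θ / 2 = N * (θ / 2) by ring]
    by_cases hs : Real.sin (θ / 2) = 0
    · simp [hs]
    · have hpos : 0 < 4 * (N : ℝ) ^ 2 * Real.sin (θ / 2) ^ 2 := by positivity
      rw [div_le_one hpos]
      have h := Literature.MathematicalPhysics.QuantumFieldTheory.Balaban1983to89.B5Prop11Leaves.abs_sin_nat_mul_le N (θ / 2)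
      have h2 : Real.sin (N * (θ / 2)) ^ 2 ≤ (N * |Real.sin (θ / 2)|) ^ 2 := by
        rw [← sq_abs (Real.sin _)]; exact pow_le_pow_left₀ (abs_nonneg _) h 2
      rw [mul_pow, sq_abs] at h2
      linarith

/-- `qqSymbol N` is continuous at every `θ` with `|θ_μ| < 2π` for all `μ` (`N ≥ 1`). [cite: King1986, (4.36) p.674] -/
theorem continuousAt_qqSymbol {n N : ℕ} (hN : 1 ≤ N) {θ : Fin n → ℝ} (hθ : ∀ μ, |θ μ| < 2 * Real.pi) : ContinuousAt (qqSymbol (dd := n) N) θ := by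
  have hfun : (qqSymbol (dd := n) N) = fun θ => ∏ μ, (Real.sinc ((N : ℝ) * θ μ / 2) / Real.sinc (θ μ / 2)) ^ 2 := by
    funext θ; unfold qqSymbol; exact Finset.prod_congr rfl fun μ _ => uFactorr_zero_eq_sinc_sq hN (θ μ)
  rw [hfun]
  refine tendsto_finsetProd _ fun μ _ => ?_
  have hne : Real.sinc (θ μ / 2) ≠ 0 := by
    by_cases h0 : θ μ / 2 = 0
    · rw [h0, Real.sinc_zero]; exact one_ne_zero
    · rw [Real.sinc_of_ne_zero h0]
      refine div_ne_zero (fun hs => ?_) h0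
      rw [Real.sin_eq_zero_iff_of_lt_of_lt (by linarith [abs_lt.mp (hθ μ)]) (by linarith [abs_lt.mp (hθ μ)])] at hs
      exact h0 hs
  have hc1 : ContinuousAt (fun θ : Fin n → ℝ => Real.sinc ((N : ℝ) * θ μ / 2)) θ :=
    (Real.continuous_sinc.comp ((continuous_const.mul (continuous_apply μ)).div_const 2)).continuousAt
  have hc2 : ContinuousAt (fun θ : Fin n → ℝ => Real.sinc (θ μ / 2)) θ :=
    (Real.continuous_sinc.comp ((continuous_apply μ).div_const 2)).continuousAt
  exact ((hc1.div hc2 hne).pow 2)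

/-! ## §3 The finite-`K` kernel as a lattice Riemann sum over the fine Brillouin zone -/

section Fine

variable {d : ℕ} (N : ℕ) [NeZero N] (M : Fin (d + 1) → ℕ) [hM : ∀ ν, NeZero (M ν)]

/-- The fine-zone integrand `F(θ) = |u(θ)|²cos(θ·Nz)∕(m² + N²Σ_μ(2 − 2cos θ_μ))`. [cite: King1986, (4.5) p.670, (4.36) p.674] -/
def fineIntegrand (N : ℕ) (m2 : ℝ) (z : Fin (d + 1) → ℤ) (θ : Fin (d + 1) → ℝ) : ℝ :=
  qqSymbol (dd := d + 1) N θ * Real.cos (∑ ν, θ ν * ((N : ℝ) * z ν)) / (m2 + (N : ℝ) ^ 2 * ∑ μ, (2 - 2 * Real.cos (θ μ)))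

/-- `F·1_{(−π,π]^{d+1}}`. [folklore] -/
def fineBoxFun (N : ℕ) (m2 : ℝ) (z : Fin (d + 1) → ℤ) (θ : Fin (d + 1) → ℝ) : ℝ :=
  if ∀ ν, -Real.pi < θ ν ∧ θ ν ≤ Real.pi then fineIntegrand N m2 z θ else 0

/-- On the fibre above `q`, the coarse character at `z` is the fine character at the block corner: `Re e^{iq·z} = cos(θ_p·Nz)`. [cite: King1986, (4.35) p.674] -/
theorem re_chi_coarse_eq_cos_fine (z : Fin (d + 1) → ℤ) (p : Tor (fine N M)) :
    (chi M (red N M p) (fun ν => ((z ν : ℤ) : ZMod (M ν)))).re = Real.cos (∑ ν, sOf (fine N M) p ν * ((N : ℝ) * z ν)) := by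
  have hc : corner N M (fun ν => ((z ν : ℤ) : ZMod (M ν))) = fun ν => (((N : ℤ) * z ν : ℤ) : ZMod (fine N M ν)) := by
    funext ν
    simp only [corner]
    have hdvd : ((fine N M ν : ℕ) : ℤ) ∣ (N : ℤ) * z ν - (N * (((z ν : ℤ) : ZMod (M ν))).val : ℕ) := by
      have h1 : ((M ν : ℕ) : ℤ) ∣ z ν - ((((z ν : ℤ) : ZMod (M ν))).val : ℤ) := by
        rw [← ZMod.intCast_eq_intCast_iff_dvd_sub]; simp
      obtain ⟨t, ht⟩ := h1
      refine ⟨t, ?_⟩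
      simp only [fine]; push_cast; linear_combination (N : ℤ) * ht
    rw [← Int.cast_natCast (R := ZMod (fine N M ν)) (N * _), ZMod.intCast_eq_intCast_iff_dvd_sub]
    exact hdvd
  rw [← chi_corner, hc, re_chi_intCast]
  push_cast
  rfl

/-- `Σ_q Σ_{p ∈ fib q} g(p) = Σ_p g(p)`. [folklore] -/
theorem sum_fib_sum (g : Tor (fine N M) → ℝ) : ∑ q : Tor M, ∑ p ∈ fib N M q, g p = ∑ p : Tor (fine N M), g p :=
  Finset.sum_fiberwise Finset.univ (red N M) g

/-- The centred representatives of the fine torus are exactly the lattice points of the half-open box. [folklore] -/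
theorem torRep_eq_iff_box (k : Fin (d + 1) → ℤ) :
    torRep (fine N M) (fun ν => ((k ν : ℤ) : ZMod (fine N M ν))) = k ↔
      ∀ ν, -Real.pi < 2 * Real.pi / ((N : ℝ) * M ν) * k ν ∧ 2 * Real.pi / ((N : ℝ) * M ν) * k ν ≤ Real.pi := by
  have hP : ∀ ν, (0 : ℝ) < (N : ℝ) * M ν := fun ν => by
    have := Nat.pos_of_ne_zero (NeZero.ne N); have := Nat.pos_of_ne_zero (NeZero.ne (M ν)); positivity
  simp only [torRep, funext_iff, ZMod.valMinAbs_spec, Set.mem_Ioc]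
  refine forall_congr' fun ν => ?_
  simp only [true_and, fine]
  push_cast
  have hπ := Real.pi_pos
  constructor
  · rintro ⟨h1, h2⟩
    have h1' : -((N : ℝ) * M ν) < k ν * 2 := by exact_mod_cast h1
    have h2' : (k ν : ℝ) * 2 ≤ (N : ℝ) * M ν := by exact_mod_cast h2
    constructor
    · rw [div_mul_eq_mul_div, lt_div_iff₀ (hP ν)]; nlinarith
    · rw [div_mul_eq_mul_div, div_le_iff₀ (hP ν)]; nlinarith
  · rintro ⟨h1, h2⟩
    rw [div_mul_eq_mul_div, lt_div_iff₀ (hP ν)] at h1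
    rw [div_mul_eq_mul_div, div_le_iff₀ (hP ν)] at h2
    constructor
    · have : -((N : ℝ) * M ν) < k ν * 2 := by nlinarith
      exact_mod_cast this
    · have : (k ν : ℝ) * 2 ≤ (N : ℝ) * M ν := by nlinarith
      exact_mod_cast this

omit [NeZero N] hM in
/-- The lattice point of a centred representative is the fine angle: `2πv(p)∕(NM) = θ_p`. [folklore] -/
theorem cornerPt_torRep (p : Tor (fine N M)) : cornerPt (fun ν => 2 * Real.pi / ((N : ℝ) * M ν)) (torRep (fine N M) p) = sOf (fine N M) p := by
  funext ν
  simp only [cornerPt, torRep, sOf, fine]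
  push_cast
  ring

/-- ★★ **THE FINITE-`K` KERNEL IS A LATTICE RIEMANN SUM OVER THE FINE ZONE**: `S₂^{(K)}_Ω(0,z) = N^{d+1}(2π)^{−(d+1)}Σ_{k∈ℤ^{d+1}}(Π_ν 2π∕(NM_ν))·(F·1_{box})(2πk∕(NM))`
(`N ≥ 1`, `m² > 0`). [cite: King1986, (4.5) p.670, (4.35)–(4.36) p.674] -/
theorem kingS2_eq_fineLatticeSum (hN1 : 1 ≤ N) {m2 : ℝ} (hm : 0 < m2) (z : Fin (d + 1) → ℤ) :
    kingS2 N M m2 0 (fun ν => ((z ν : ℤ) : ZMod (M ν)))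
      = (N : ℝ) ^ (d + 1) * (((2 * Real.pi) ^ (d + 1))⁻¹
          * ∑' k : Fin (d + 1) → ℤ, (∏ ν, 2 * Real.pi / ((N : ℝ) * M ν)) * fineBoxFun N m2 z (cornerPt (fun ν => 2 * Real.pi / ((N : ℝ) * M ν)) k)) := by
  have hπ : (2 * Real.pi) ^ (d + 1) ≠ 0 := pow_ne_zero _ (mul_ne_zero two_ne_zero Real.pi_ne_zero)
  have hNr : (N : ℝ) ≠ 0 := by exact_mod_cast (show N ≠ 0 by omega)
  -- the kernel as one sum over the fine torus
  have hker : kingS2 N M m2 0 (fun ν => ((z ν : ℤ) : ZMod (M ν)))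
      = (Fintype.card (Tor M) : ℝ)⁻¹ * ∑ p : Tor (fine N M), fineIntegrand N m2 z (sOf (fine N M) p) := by
    rw [kingS2_eq_fourier N M hm]
    congr 1
    simp_rw [sub_zero]
    rw [← sum_fib_sum N M]
    refine Finset.sum_congr rfl fun q _ => ?_
    unfold Sfib
    rw [Finset.sum_mul]
    refine Finset.sum_congr rfl fun p hp => ?_
    have hq : red N M p = q := (Finset.mem_filter.mp hp).2
    rw [← hq, re_chi_coarse_eq_cos_fine, fineIntegrand, norm_sq_u N M hN1 p, lapSym]
    ring
  -- the sum over the fine torus as a lattice sum supported on centred representatives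
  have hsupp : Function.support (fun k : Fin (d + 1) → ℤ => fineBoxFun N m2 z (cornerPt (fun ν => 2 * Real.pi / ((N : ℝ) * M ν)) k))
      ⊆ Set.range (torRep (fine N M)) := by
    intro k hk
    rw [Function.mem_support] at hk
    unfold fineBoxFun at hk
    by_cases hbox : ∀ ν, -Real.pi < cornerPt (fun ν => 2 * Real.pi / ((N : ℝ) * M ν)) k ν ∧ cornerPt (fun ν => 2 * Real.pi / ((N : ℝ) * M ν)) k ν ≤ Real.pi
    · exact ⟨_, (torRep_eq_iff_box N M k).mpr hbox⟩
    · rw [if_neg hbox] at hk; exact absurd rfl hk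
  have hlat : ∑ p : Tor (fine N M), fineIntegrand N m2 z (sOf (fine N M) p)
      = ∑' k : Fin (d + 1) → ℤ, fineBoxFun N m2 z (cornerPt (fun ν => 2 * Real.pi / ((N : ℝ) * M ν)) k) := by
    rw [← (torRep_injective (fine N M)).tsum_eq hsupp, tsum_fintype]
    refine Finset.sum_congr rfl fun p _ => ?_
    have hbox : ∀ ν, -Real.pi < cornerPt (fun ν => 2 * Real.pi / ((N : ℝ) * M ν)) (torRep (fine N M) p) ν
        ∧ cornerPt (fun ν => 2 * Real.pi / ((N : ℝ) * M ν)) (torRep (fine N M) p) ν ≤ Real.pi :=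
      (torRep_eq_iff_box N M (torRep (fine N M) p)).mp (by rw [intCast_torRep])
    rw [fineBoxFun, if_pos hbox, cornerPt_torRep]
  have hcard : (Fintype.card (Tor M) : ℝ)⁻¹ = (N : ℝ) ^ (d + 1) * (((2 * Real.pi) ^ (d + 1))⁻¹ * ∏ ν, 2 * Real.pi / ((N : ℝ) * M ν)) := by
    have h1 : (Fintype.card (Tor M) : ℝ) = ∏ ν, (M ν : ℝ) := by
      rw [Fintype.card_pi]; push_cast; simp only [ZMod.card]
    have h2 : ∏ ν : Fin (d + 1), 2 * Real.pi / ((N : ℝ) * M ν) = (2 * Real.pi) ^ (d + 1) / ((N : ℝ) ^ (d + 1) * ∏ ν, (M ν : ℝ)) := by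
      rw [Finset.prod_div_distrib, Finset.prod_mul_distrib, Finset.prod_mul_distrib]
      simp only [Finset.prod_const, Finset.card_univ, Fintype.card_fin]
      ring
    have hNp : (N : ℝ) ^ (d + 1) ≠ 0 := pow_ne_zero _ hNr
    rw [h1, h2, div_eq_mul_inv, ← mul_assoc ((2 * Real.pi) ^ (d + 1))⁻¹, inv_mul_cancel₀ hπ, one_mul, mul_inv, ← mul_assoc, mul_inv_cancel₀ hNp, one_mul]
  rw [hker, hlat, hcard, mul_assoc, mul_assoc, ← tsum_mul_left]

end Fine

/-! ## §4 The finite-`K` thermodynamic limit -/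

section Limit

variable {d : ℕ}

/-- **The finite-`K` infinite-volume kernel** `V_N(z) = N^{d+1}(2π)^{−(d+1)}∫ (F·1_{(−π,π]^{d+1}})`. [cite: King1986, Thm 2.1 (2.22) p.654, (4.5) p.670] -/
def kingS2InfK (N : ℕ) (m2 : ℝ) (z : Fin (d + 1) → ℤ) : ℝ :=
  (N : ℝ) ^ (d + 1) * (((2 * Real.pi) ^ (d + 1))⁻¹ * ∫ θ : Fin (d + 1) → ℝ, fineBoxFun N m2 z θ)

/-- `|F(θ)| ≤ m⁻²` (`|u|² ≤ 1`, `|cos| ≤ 1`, denominator `≥ m²`). [cite: King1986, (4.8) p.671] -/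
theorem abs_fineIntegrand_le {N : ℕ} (hN1 : 1 ≤ N) {m2 : ℝ} (hm : 0 < m2) (z : Fin (d + 1) → ℤ) (θ : Fin (d + 1) → ℝ) :
    |fineIntegrand N m2 z θ| ≤ m2⁻¹ := by
  have hq1 : qqSymbol (dd := d + 1) N θ ≤ 1 := by
    unfold qqSymbol
    calc ∏ μ, B4Strip.uFactorr N 0 ((N : ℝ) * θ μ) ≤ ∏ _μ : Fin (d + 1), (1 : ℝ) :=
          Finset.prod_le_prod (fun μ _ => B4Strip.uFactorr_nonneg _ _ _) fun μ _ => uFactorr_zero_le_one hN1 (θ μ)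
      _ = 1 := by simp
  have hq0 := qqSymbol_nonneg (dd := d + 1) N θ
  have hden : m2 ≤ m2 + (N : ℝ) ^ 2 * ∑ μ, (2 - 2 * Real.cos (θ μ)) := by
    have : 0 ≤ ∑ μ : Fin (d + 1), (2 - 2 * Real.cos (θ μ)) := Finset.sum_nonneg fun μ _ => by linarith [Real.cos_le_one (θ μ)]
    nlinarith
  have hdenpos : 0 < m2 + (N : ℝ) ^ 2 * ∑ μ, (2 - 2 * Real.cos (θ μ)) := by linarith
  unfold fineIntegrand
  rw [abs_div, abs_mul, abs_of_nonneg hq0, abs_of_pos hdenpos]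
  calc qqSymbol N θ * |Real.cos (∑ ν, θ ν * ((N : ℝ) * z ν))| / (m2 + (N : ℝ) ^ 2 * ∑ μ, (2 - 2 * Real.cos (θ μ)))
      ≤ 1 * 1 / m2 := by gcongr; exact Real.abs_cos_le_one _
    _ = m2⁻¹ := by rw [mul_one, one_div]

/-- `F` is continuous at every interior point of the zone `|θ_μ| < 2π`. [cite: King1986, (4.5) p.670] -/
theorem continuousAt_fineIntegrand {N : ℕ} (hN1 : 1 ≤ N) {m2 : ℝ} (hm : 0 < m2) (z : Fin (d + 1) → ℤ) {θ : Fin (d + 1) → ℝ} (hθ : ∀ μ, |θ μ| < 2 * Real.pi) :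
    ContinuousAt (fineIntegrand N m2 z) θ := by
  unfold fineIntegrand
  refine ContinuousAt.div (ContinuousAt.mul (continuousAt_qqSymbol hN1 hθ) ?_) ?_ (ne_of_gt ?_)
  · exact (Real.continuous_cos.comp (continuous_finsetSum _ fun ν _ => (continuous_apply ν).mul continuous_const)).continuousAt
  · exact (continuous_const.add (continuous_const.mul (continuous_finsetSum _ fun μ _ =>
      continuous_const.sub (continuous_const.mul (Real.continuous_cos.comp (continuous_apply μ)))))).continuousAt
  · have : 0 ≤ ∑ μ : Fin (d + 1), (2 - 2 * Real.cos (θ μ)) := Finset.sum_nonneg fun μ _ => by linarith [Real.cos_le_one (θ μ)]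
    positivity

/-- ★★★ **THE THERMODYNAMIC LIMIT AT FINITE `K`**: for `N ≥ 1`, `m² > 0`, along ANY tori with all periods `M_{k,ν} → ∞`:
`S₂^{(K)}_{Ω_k}(0, z mod M_k) → V_N(z)` (`N = L^K` fixed). [cite: King1986, Thm 2.1 (2.22) p.654, (4.5) p.670] -/
theorem tendsto_kingS2_volume {N : ℕ} [NeZero N] (hN1 : 1 ≤ N) {m2 : ℝ} (hm : 0 < m2) (Mseq : ℕ → Fin (d + 1) → ℕ) (hpos : ∀ k ν, 0 < Mseq k ν)
    (hlim : ∀ ν, Tendsto (fun k => (Mseq k ν : ℝ)) atTop atTop) (z : Fin (d + 1) → ℤ) :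
    Tendsto (fun k => haveI : ∀ ν, NeZero (Mseq k ν) := fun ν => ⟨(hpos k ν).ne'⟩
      kingS2 N (Mseq k) m2 0 (fun ν => ((z ν : ℤ) : ZMod (Mseq k ν)))) atTop (𝓝 (kingS2InfK N m2 z)) := by
  have hπ := Real.pi_pos
  have hNr : (0 : ℝ) < N := by exact_mod_cast (show 0 < N by omega)
  set ℓ : ℕ → Fin (d + 1) → ℝ := fun k ν => 2 * Real.pi / ((N : ℝ) * Mseq k ν) with hℓ
  have hℓpos : ∀ k ν, 0 < ℓ k ν := fun k ν => by
    have : (0 : ℝ) < Mseq k ν := by exact_mod_cast hpos k ν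
    simp only [hℓ]; positivity
  have hℓle : ∀ k ν, ℓ k ν ≤ 2 * Real.pi := fun k ν => by
    have h1 : (1 : ℝ) ≤ (N : ℝ) * Mseq k ν := by
      have : (1 : ℝ) ≤ Mseq k ν := by exact_mod_cast hpos k ν
      have : (1 : ℝ) ≤ N := by exact_mod_cast hN1
      nlinarith
    simp only [hℓ]; rw [div_le_iff₀ (by linarith)]; nlinarith
  have hℓ0 : ∀ ν, Tendsto (fun k => ℓ k ν) atTop (𝓝 0) := fun ν => by
    simp only [hℓ]
    exact (tendsto_const_nhds (x := 2 * Real.pi)).div_atTop ((hlim ν).const_mul_atTop hNr)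
  -- domination by the box indicator (window `[−3π, 3π]`)
  have hdom : ∀ k x, |fineBoxFun N m2 z (cornerPt (ℓ k) (floorIdx (ℓ k) x))| ≤ m2⁻¹ * ∏ ν : Fin (d + 1), Set.indicator (Set.Icc (-(3 * Real.pi)) (3 * Real.pi)) (fun _ => (1 : ℝ)) (x ν) := by
    intro k x
    unfold fineBoxFun
    split_ifs with hbox
    · refine (abs_fineIntegrand_le hN1 hm z _).trans (le_mul_of_one_le_right (by positivity) ?_)
      have : ∏ ν : Fin (d + 1), Set.indicator (Set.Icc (-(3 * Real.pi)) (3 * Real.pi)) (fun _ => (1 : ℝ)) (x ν) = 1 := by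
        refine Finset.prod_eq_one fun ν _ => ?_
        have hx := abs_le.mp (abs_sub_cornerPt_le (hℓpos k) x ν)
        have hb := hbox ν
        rw [Set.indicator_of_mem]
        rw [Set.mem_Icc]
        constructor <;> linarith [hℓle k ν, hx.1, hx.2, hb.1, hb.2]
      rw [this]
    · rw [abs_zero]; exact mul_nonneg (by positivity) (Finset.prod_nonneg fun ν _ => Set.indicator_nonneg (fun _ _ => zero_le_one) _)
  have hG : Integrable fun x : Fin (d + 1) → ℝ => m2⁻¹ * ∏ ν : Fin (d + 1), Set.indicator (Set.Icc (-(3 * Real.pi)) (3 * Real.pi)) (fun _ => (1 : ℝ)) (x ν) := by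
    refine (integrable_prodEnvelope ?_).const_mul _
    exact (integrable_indicator_iff measurableSet_Icc).mpr (integrableOn_const (by rw [Real.volume_Icc]; exact ENNReal.ofReal_ne_top))
  -- a.e. pointwise convergence (off the boundary hyperplanes `|x_ν| = π`)
  have hae : ∀ᵐ x : Fin (d + 1) → ℝ, Tendsto (fun k => fineBoxFun N m2 z (cornerPt (ℓ k) (floorIdx (ℓ k) x))) atTop (𝓝 (fineBoxFun N m2 z x)) := by
    have hnull : ∀ ν : Fin (d + 1), volume {x : Fin (d + 1) → ℝ | x ν = Real.pi} = 0 ∧ volume {x : Fin (d + 1) → ℝ | x ν = -Real.pi} = 0 := fun ν => by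
      constructor <;> (rw [MeasureTheory.volume_pi]; exact Measure.pi_hyperplane _ ν _)
    have hS : volume (⋃ ν : Fin (d + 1), ({x : Fin (d + 1) → ℝ | x ν = Real.pi} ∪ {x | x ν = -Real.pi})) = 0 := by
      refine measure_iUnion_null fun ν => ?_
      rw [measure_union_null_iff]; exact hnull ν
    refine (ae_iff.mpr ((measure_mono_null (fun x hx => ?_) hS)))
    · -- if `x` is off all boundary hyperplanes, convergence holds
      simp only [Set.mem_setOf_eq, Set.mem_iUnion, Set.mem_union] at hx ⊢
      by_contra hnot
      push Not at hnot
      apply hx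
      have hconv := tendsto_cornerPt ℓ hℓpos hℓ0 x
      by_cases hin : ∀ ν, |x ν| < Real.pi
      · -- interior: eventually the lattice point is in the box, and `F` is continuous at `x`
        have hcont : ContinuousAt (fineIntegrand N m2 z) x := continuousAt_fineIntegrand hN1 hm z fun μ => by linarith [hin μ]
        have hev : ∀ᶠ k in atTop, ∀ ν, -Real.pi < cornerPt (ℓ k) (floorIdx (ℓ k) x) ν ∧ cornerPt (ℓ k) (floorIdx (ℓ k) x) ν ≤ Real.pi := by
          have h1 : ∀ ν, ∀ᶠ k in atTop, -Real.pi < cornerPt (ℓ k) (floorIdx (ℓ k) x) ν ∧ cornerPt (ℓ k) (floorIdx (ℓ k) x) ν < Real.pi := fun ν => by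
            have hν := (tendsto_pi_nhds.mp hconv) ν
            have hlo := hν.eventually (eventually_gt_nhds (show -Real.pi < x ν by linarith [abs_lt.mp (hin ν)]))
            have hhi := hν.eventually (eventually_lt_nhds (show x ν < Real.pi by linarith [abs_lt.mp (hin ν)]))
            exact hlo.and hhi
          filter_upwards [Filter.eventually_all.mpr h1] with k hk ν using ⟨(hk ν).1, (hk ν).2.le⟩
        have hxbox : ∀ ν, -Real.pi < x ν ∧ x ν ≤ Real.pi := fun ν => ⟨by linarith [abs_lt.mp (hin ν)], by linarith [abs_lt.mp (hin ν)]⟩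
        rw [show fineBoxFun N m2 z x = fineIntegrand N m2 z x by rw [fineBoxFun, if_pos hxbox]]
        refine ((hcont.tendsto.comp hconv).congr' ?_)
        filter_upwards [hev] with k hk
        rw [Function.comp_apply, fineBoxFun, if_pos hk]
      · -- exterior: some `|x_ν| > π` (equality excluded), eventually outside the box
        push Not at hin
        obtain ⟨ν, hν⟩ := hin
        have hgt : Real.pi < |x ν| := lt_of_le_of_ne hν (fun h => by
          rcases le_or_gt 0 (x ν) with h0 | h0
          · exact (hnot ν).1 (by rw [abs_of_nonneg h0] at h; exact h.symm)
          · exact (hnot ν).2 (by rw [abs_of_neg h0] at h; linarith))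
        have hxout : ¬ (∀ μ, -Real.pi < x μ ∧ x μ ≤ Real.pi) := fun h => by
          have := h ν; rcases le_or_gt 0 (x ν) with h0 | h0
          · rw [abs_of_nonneg h0] at hgt; linarith [this.2]
          · rw [abs_of_neg h0] at hgt; linarith [this.1]
        rw [show fineBoxFun N m2 z x = 0 by rw [fineBoxFun, if_neg hxout]]
        have hνc := (tendsto_pi_nhds.mp hconv) ν
        have hev : ∀ᶠ k in atTop, ¬ (∀ μ, -Real.pi < cornerPt (ℓ k) (floorIdx (ℓ k) x) μ ∧ cornerPt (ℓ k) (floorIdx (ℓ k) x) μ ≤ Real.pi) := by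
          rcases le_or_gt 0 (x ν) with h0 | h0
          · rw [abs_of_nonneg h0] at hgt
            filter_upwards [hνc.eventually (eventually_gt_nhds hgt)] with k hk h
            linarith [(h ν).2]
          · rw [abs_of_neg h0] at hgt
            filter_upwards [hνc.eventually (eventually_lt_nhds (show x ν < -Real.pi by linarith))] with k hk h
            linarith [(h ν).1]
        refine tendsto_const_nhds.congr' ?_
        filter_upwards [hev] with k hk
        rw [fineBoxFun, if_neg hk]
  have heng := tendsto_latticeSum_of_dominated_ae ℓ hℓpos (fun k b => fineBoxFun N m2 z (cornerPt (ℓ k) b)) (fineBoxFun N m2 z) _ hG hdom hae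
  have h2 := heng.const_mul ((N : ℝ) ^ (d + 1) * ((2 * Real.pi) ^ (d + 1))⁻¹)
  unfold kingS2InfK
  rw [← mul_assoc]
  refine h2.congr fun k => ?_
  haveI : ∀ ν, NeZero (Mseq k ν) := fun ν => ⟨(hpos k ν).ne'⟩
  rw [kingS2_eq_fineLatticeSum N (Mseq k) hN1 hm z, mul_assoc]

end Limit

end Summit.QuantumFields.YangMills.BalabanUVNodes.N15KingModelRung

end
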